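import Summits.Ventures.HodgeRepro2.T5SU11SphericalLegendreLaplace
import Mathlib.RingTheory.PowerSeries.Derivative

/-!
# The generating function of the Legendre polynomials, formally: `(Σ_n P_n(x) Tⁿ)² · (1 − 2xT + T²) = 1`

With the Legendre polynomials DEFINED by Bonnet's recursion (`T5SU11SphericalLegendreAll.legP`) and identified with
the spherical functions `φ_{2n+2}(a_t) = P_n(cosh 2t)`, this file proves the classical generating-function identity
in the ring of formal power series `ℝ⟦T⟧`: for `G_x := Σ_n P_n(x) Tⁿ` (`legSeries x`) and `Q_x := 1 − 2x T + T²`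
(`legQuad x`),

* Bonnet's recursion is the first-order equation **`Q_x · G_x' = (x − T) · G_x`** (`legQuad_mul_derivative`);
* hence `(G_x² Q_x)' = 0` and **`G_x² · Q_x = 1`** (`legSeries_sq_mul_legQuad`) — `G_x = (1 − 2xT + T²)^{−1/2}`,
  with the square root pinned down by the constant term: **any `H` with `H² Q_x = 1` and `H(0) = 1` is `G_x`**
  (`eq_legSeries_of_sq_mul`);
* in coefficients, with `q_n := Σ_{i+j=n} P_i(x) P_j(x)`: **`q_0 = 1`, `q_1 = 2x`, `q_{n+2} − 2x q_{n+1} + q_n = 0`**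
  (`coeff_legSeries_sq_zero`, `coeff_legSeries_sq_one`, `coeff_legSeries_sq_recursion`) — the three-term
  recursion of the convolution squares, used by `T5SU11LegendreGenerating` for the analytic identity
  `Σ_n P_n(x) rⁿ = (1 − 2xr + r²)^{−1/2}`.

Nothing is claimed about (N).

Blind lane: Mathlib + the HodgeRepro2 prefix only; no sorry; axioms ⊆ {propext, Classical.choice,
Quot.sound}.
-/

namespace Summit.Ventures.HodgeRepro2.T5SU11LegendreGeneratingFormal

open PowerSeries Finset
open T5SU11SphericalLegendreAll

/-! ### The generating function and the quadratic -/

/-- **The generating function `G_x = Σ_n P_n(x) Tⁿ`** as a formal power series. -/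
noncomputable def legSeries (x : ℝ) : ℝ⟦X⟧ := PowerSeries.mk fun n => legP n x

/-- **The quadratic `Q_x = 1 − 2x T + T²`.** -/
noncomputable def legQuad (x : ℝ) : ℝ⟦X⟧ := 1 - C (2 * x) * X + X ^ 2

/-- `coeff n G_x = P_n(x)`. -/
@[simp] theorem coeff_legSeries (x : ℝ) (n : ℕ) : coeff n (legSeries x) = legP n x := coeff_mk n _

/-- `G_x(0) = 1`. -/
theorem constantCoeff_legSeries (x : ℝ) : constantCoeff (legSeries x) = 1 := by
  rw [← coeff_zero_eq_constantCoeff_apply, coeff_legSeries, legP_zero]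

/-- `Q_x(0) = 1`. -/
theorem constantCoeff_legQuad (x : ℝ) : constantCoeff (legQuad x) = 1 := by
  simp [legQuad]

/-- The coefficients of `Q_x`: `1, −2x, 1, 0, 0, …`. -/
theorem coeff_legQuad (x : ℝ) (n : ℕ) :
    coeff n (legQuad x) = if n = 0 then 1 else if n = 1 then -(2 * x) else if n = 2 then 1 else 0 := by
  rcases n with _ | _ | _ | n
  · simp [legQuad]
  · simp [legQuad, coeff_X_pow]
  · simp [legQuad, coeff_X_pow]
  · simp [legQuad, coeff_X_pow]

/-- The derivative of the quadratic: `Q_x' = 2T − 2x`. -/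
theorem derivative_legQuad (x : ℝ) : d⁄dX ℝ (legQuad x) = 2 * X - C (2 * x) := by
  rw [legQuad]
  simp only [map_add, map_sub, Derivation.map_one_eq_zero, Derivation.leibniz, derivative_C, derivative_X,
    Derivation.leibniz_pow, smul_eq_mul, nsmul_eq_mul]
  push_cast
  ring

/-- `C (2x) = 2 · C x` in `ℝ⟦T⟧`. -/
theorem C_two_mul (x : ℝ) : (C (2 * x) : ℝ⟦X⟧) = 2 * C x := by
  rw [map_mul, map_ofNat]

/-! ### Bonnet's recursion as a first-order equation -/

/-- **`Q_x · G_x' = (x − T) · G_x`**: Bonnet's recursion `(n + 1) P_{n+1} = (2n + 1) x P_n − n P_{n−1}`, read as a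
differential equation for the generating function. -/
theorem legQuad_mul_derivative (x : ℝ) :
    legQuad x * d⁄dX ℝ (legSeries x) = (C x - X) * legSeries x := by
  set G := legSeries x with hG
  set D := d⁄dX ℝ (legSeries x) with hD
  have e : legQuad x * D = D - C (2 * x) * (X * D) + X ^ 2 * D := by rw [legQuad]; ring
  have e' : (C x - X) * G = C x * G - X * G := by ring
  rw [e, e']
  ext n
  simp only [map_add, map_sub, coeff_C_mul]
  rcases n with _ | _ | n
  · simp only [coeff_zero_X_mul, coeff_X_pow_mul', hD, coeff_derivative, hG, coeff_legSeries]
    simp [legP_one']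
  · simp only [coeff_succ_X_mul, coeff_X_pow_mul', hD, coeff_derivative, hG, coeff_legSeries]
    simp only [show ¬ (2 ≤ 1) by norm_num, if_false]
    rw [legP_two]
    simp only [zero_add, legP_one', Nat.cast_zero, legP_zero]
    ring
  · have h2 : coeff (n + 1 + 1) (X ^ 2 * D) = coeff n D := coeff_X_pow_mul D 2 n
    rw [h2]
    simp only [coeff_succ_X_mul, hD, coeff_derivative, hG, coeff_legSeries]
    have hb := legP_succ_succ (n + 1) x
    push_cast at hb ⊢
    have hn : (n : ℝ) + 1 + 2 ≠ 0 := by positivity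
    rw [show n + 1 + 2 = n + 3 by ring, show n + 1 + 1 + 1 = n + 3 by ring] at *
    field_simp at hb
    linear_combination hb

/-! ### The generating function identity -/

/-- **`G_x² · Q_x = 1`**: the generating function of the Legendre polynomials is `(1 − 2xT + T²)^{−1/2}`. -/
theorem legSeries_sq_mul_legQuad (x : ℝ) : legSeries x * legSeries x * legQuad x = 1 := by
  refine PowerSeries.derivative.ext ?_ ?_
  · rw [Derivation.map_one_eq_zero, Derivation.leibniz, Derivation.leibniz, derivative_legQuad, smul_eq_mul,
      smul_eq_mul, smul_eq_mul, C_two_mul]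
    have hode := legQuad_mul_derivative x
    linear_combination (2 * legSeries x) * hode
  · rw [map_mul, map_mul, constantCoeff_legSeries, constantCoeff_legQuad, map_one]
    ring

/-- **Uniqueness of the square root**: any `H ∈ ℝ⟦T⟧` with `H² Q_x = 1` and `H(0) = 1` is `G_x`. -/
theorem eq_legSeries_of_sq_mul (x : ℝ) {H : ℝ⟦X⟧} (hH : H * H * legQuad x = 1) (h0 : constantCoeff H = 1) :
    H = legSeries x := by
  have hQ : legQuad x ≠ 0 := fun h => by
    have := constantCoeff_legQuad x
    rw [h, map_zero] at this
    exact zero_ne_one this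
  have hsum : H + legSeries x ≠ 0 := fun h => by
    have := congrArg constantCoeff h
    rw [map_add, h0, constantCoeff_legSeries, map_zero] at this
    norm_num at this
  have hsq : (H - legSeries x) * (H + legSeries x) * legQuad x = 0 := by
    linear_combination hH - legSeries_sq_mul_legQuad x
  rcases mul_eq_zero.mp hsq with h | h
  · rcases mul_eq_zero.mp h with h | h
    · exact sub_eq_zero.mp h
    · exact absurd h hsum
  · exact absurd h hQ

/-! ### The convolution squares `q_n = Σ_{i+j=n} P_i(x) P_j(x)` -/

/-- `q_n = Σ_{(i,j) ∈ antidiagonal n} P_i(x) P_j(x)`. -/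
theorem coeff_legSeries_sq (x : ℝ) (n : ℕ) :
    coeff n (legSeries x * legSeries x) = ∑ ij ∈ antidiagonal n, legP ij.1 x * legP ij.2 x := by
  rw [coeff_mul]
  simp only [coeff_legSeries]

/-- The coefficients of `G_x² Q_x`: `q_n − 2x q_{n−1} + q_{n−2}` (with `q_{−1} = q_{−2} = 0`). -/
theorem coeff_legSeries_sq_mul_legQuad (x : ℝ) (n : ℕ) :
    coeff (n + 2) (legSeries x * legSeries x * legQuad x)
      = coeff (n + 2) (legSeries x * legSeries x) - 2 * x * coeff (n + 1) (legSeries x * legSeries x)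
        + coeff n (legSeries x * legSeries x) := by
  set S := legSeries x * legSeries x with hS
  have e : S * legQuad x = S - C (2 * x) * (X * S) + X ^ 2 * S := by rw [legQuad]; ring
  rw [e, map_add, map_sub, coeff_C_mul, coeff_succ_X_mul, coeff_X_pow_mul S 2 n]

/-- **`q_0 = 1`.** -/
theorem coeff_legSeries_sq_zero (x : ℝ) : coeff 0 (legSeries x * legSeries x) = 1 := by
  rw [coeff_zero_eq_constantCoeff_apply, map_mul, constantCoeff_legSeries, mul_one]

/-- **`q_1 = 2x`.** -/
theorem coeff_legSeries_sq_one (x : ℝ) : coeff 1 (legSeries x * legSeries x) = 2 * x := by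
  rw [coeff_legSeries_sq, Finset.Nat.sum_antidiagonal_eq_sum_range_succ_mk, Finset.sum_range_succ,
    Finset.sum_range_one]
  simp only [Nat.sub_zero, Nat.sub_self, legP_zero, legP_one']
  ring

/-- **The three-term recursion `q_{n+2} − 2x q_{n+1} + q_n = 0`** of the convolution squares. -/
theorem coeff_legSeries_sq_recursion (x : ℝ) (n : ℕ) :
    coeff (n + 2) (legSeries x * legSeries x) - 2 * x * coeff (n + 1) (legSeries x * legSeries x)
      + coeff n (legSeries x * legSeries x) = 0 := by
  rw [← coeff_legSeries_sq_mul_legQuad, legSeries_sq_mul_legQuad, coeff_one]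
  simp

end Summit.Ventures.HodgeRepro2.T5SU11LegendreGeneratingFormal
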